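import Summits.NavierStokesRegularity.NavierStokesRegularity.Theses.TypeICertificateLadder
import Summits.NavierStokesRegularity.NavierStokesRegularity.Theorems.RungReynoldsOne.Negative.WithoutLerayHopfFalse
import Literature.Analysis.FluidPDE.NSQuasipotential

/-!
# `TypeIConcentration` (stmt-NavierStokesRegularity-2881): load-bearing hypotheses, the rate
# ceiling, and vacuity below Leray's floor

Negative (support) lemmas for the crux `TypeICertificateLadder.TypeIConcentration` (route
TypeICertificateLadder, rank 4), extracted from the crux work file
`Cruxes/TypeIConcentration/Disproof.lean` (cdisprove seats, generations 1–3) so that ideators,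
planners and provers can IMPORT them. The crux: for every Type-I constant `C` there are `ρ, γ > 0`
depending on `C` only such that a classical Leray–Hopf solution on `ℝ³ × [0,T)` from a rapidly
decaying datum with the eventual rate `√(T−t)‖u(t,x)‖ ≤ C√ν` and no smooth extension past `T` has a
fixed centre `x₀` with `γ ν³ ≤ ∫_{B(x₀, ρ√(ν(T−t)))} ‖u(t)‖³` for all `t < T` near `T`.

* `typeIConcentration_false_without_noExtension` — drop `¬ HasSmoothExtensionPast`: FALSE (rest state).
* `typeIConcentration_level_false_without_LerayHopf` / `typeIConcentration_false_without_LerayHopf` —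
  drop `IsLerayHopfOn`: FALSE at EVERY level `C > 0`. Witness: the Type-I drift
  `u = g_c(t)·driftDir`, `p = −g_c′(t) x₀`, `g_c(t) = c((1−t)^{-1/2} − 1)` of the sibling file
  `RungReynoldsOne/Negative/WithoutLerayHopfFalse.lean` (classical for every viscosity, Schwartz datum
  `0`, exact Type-I rate `c(1 − √(1−t)) ≤ c ≤ C`, no continuation), whose local `L³` mass at the
  similarity scale is `|B₁| ρ³ c³ (1 − √(1−t))³ < γ` once `c` is small (`mass_driftI_le`). The one
  violated clause is finite energy (`not_memLp_driftI`). MORAL: `γ(C)` is an ε-regularity /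
  no-nucleation threshold paid for by the energy structure, never a consequence of rate + PDE + datum.
* `scaledEnergyBound_false_without_LerayHopf` — the same witness kills the support item
  `ScaledEnergyBound` (stmt-…-2884) without Leray–Hopf: at a FIXED radius the scaled local energy of
  the drift is `|B₁| r² g(t)² → ∞`; the pointwise rate controls only radii `r ≲ √(ν(T−t))`.
* `calmCoresPersist_core_false_without_LerayHopf` — the no-nucleation statement PROP M of the line
  `oseen-tail-calm-core-confinement` (stub `stub_calmCoresPersist`, its analytic hypotheses and the
  Leray–Hopf clause removed) is FALSE: the drift is quiet (`≡ 0`) at `t₁ = 0` everywhere, obeys the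
  envelope with `C = 1`, and reaches `√(1−s)‖u(s)‖ = 3/4 > 4c` at `s = 15/16`. So PROP M, like the
  crux, must spend finite energy (in the line: the Oseen/mild representation).
* `mass_le_of_rate`, `no_witness_above_rate_ceiling` — TIGHTNESS: under the rate alone the witness
  functional is `≤ |B₁| ρ³ C³ ν³` around every centre, so only pairs `γ ≤ |B₁| ρ³ C³` can witness.
* `typeIConcentration_hyps_false_below_rungZero` — VACUITY BELOW LERAY'S FLOOR: for `C ≤ C₀`
  (`C₀` of the proved `RungZero`) the five hypotheses of the crux are contradictory, so the crux has
  content only for `C > C₀`.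

[cite: KochNadirashviliSereginSverak2009, §1 p. 3 (parasitic solutions `u = g(t)`, `p = −g′·x`)]
-/

noncomputable section

set_option linter.dupNamespace false

namespace Summit.NavierStokesRegularity.NavierStokesRegularity.Theorems.TypeIConcentration.Negative

open Set Filter Topology MeasureTheory Metric Function
open Literature.Analysis.FluidPDE
open Summit.NavierStokesRegularity.NavierStokesRegularity.Theorems.RungReynoldsOneNegative

/-! ## Ball volumes (`|B₁| = (volume (ball 0 1)).toReal = 4π/3`; only `0 < |B₁| < ∞` is used) -/

/-- `|B(x₀, r)| = r³ |B₁|` as real numbers (`r ≥ 0`). [folklore] -/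
theorem volume_real_ball_eq (x₀ : EuclideanSpace ℝ (Fin 3)) {r : ℝ} (hr : 0 ≤ r) :
    volume.real (ball x₀ r) = r ^ 3 * (volume (Metric.ball (0 : EuclideanSpace ℝ (Fin 3)) 1)).toReal := by
  rw [measureReal_def, Measure.addHaar_ball volume x₀ hr, finrank_euclideanSpace_fin, ENNReal.toReal_mul,
    ENNReal.toReal_ofReal (by positivity)]

/-! ## Tightness: the rate ceiling on the witness functional -/

/-- **Rate ceiling.** Under the eventual Type-I(`C`) rate alone, the local `L³` mass at the
similarity scale is eventually `≤ |B₁| ρ³ C³ ν³` around EVERY centre (`ν ≥ 0`, `ρ ≥ 0`): the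
crux's witness functional is bounded on the Type-I(`C`) class. [folklore] -/
theorem mass_le_of_rate {C ν T : ℝ} (hν : 0 ≤ ν) {u : ℝ → EuclideanSpace ℝ (Fin 3) → EuclideanSpace ℝ (Fin 3)}
    (hrate : ∀ᶠ t in 𝓝[<] T, ∀ x, Real.sqrt (T - t) * ‖u t x‖ ≤ C * Real.sqrt ν)
    {ρ : ℝ} (hρ : 0 ≤ ρ) (x₀ : EuclideanSpace ℝ (Fin 3)) :
    ∀ᶠ t in 𝓝[<] T, ∫ x in ball x₀ (ρ * Real.sqrt (ν * (T - t))), ‖u t x‖ ^ 3 ≤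
      (volume (Metric.ball (0 : EuclideanSpace ℝ (Fin 3)) 1)).toReal * ρ ^ 3 * C ^ 3 * ν ^ 3 := by
  filter_upwards [hrate, self_mem_nhdsWithin] with t ht htT
  have hpos : 0 < Real.sqrt (T - t) := Real.sqrt_pos.2 (sub_pos.2 htT)
  have hC : 0 ≤ C * Real.sqrt ν := le_trans (by positivity) (ht x₀)
  set r := ρ * Real.sqrt (ν * (T - t)) with hr
  have hr0 : 0 ≤ r := by positivity
  have hbound : ∀ x ∈ ball x₀ r, ‖‖u t x‖ ^ 3‖ ≤ (C * Real.sqrt ν / Real.sqrt (T - t)) ^ 3 := by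
    intro x _
    rw [Real.norm_of_nonneg (by positivity)]
    have hx : ‖u t x‖ ≤ C * Real.sqrt ν / Real.sqrt (T - t) := by
      rw [le_div_iff₀ hpos]; simpa [mul_comm] using ht x
    exact pow_le_pow_left₀ (norm_nonneg _) hx 3
  have h1 := norm_setIntegral_le_of_norm_le_const
    (measure_ball_lt_top : volume (ball x₀ r) < ⊤) hbound
  rw [volume_real_ball_eq x₀ hr0] at h1
  refine (Real.le_norm_self _).trans (h1.trans (le_of_eq ?_))
  have hs : Real.sqrt (ν * (T - t)) = Real.sqrt ν * Real.sqrt (T - t) := Real.sqrt_mul hν _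
  rw [hr, hs, div_pow, mul_pow, mul_pow, mul_pow]
  have hνs : Real.sqrt ν ^ 3 * Real.sqrt ν ^ 3 = ν ^ 3 := by
    rw [← mul_pow, Real.mul_self_sqrt hν]
  field_simp
  rw [← hνs]; ring

/-- **No admissible witness above the ceiling.** If a field with the eventual Type-I(`C`) rate
(`ν > 0`) concentrates with constants `(ρ, γ)` around some centre, then `γ ≤ |B₁| ρ³ C³`: in the
crux only pairs with `γ ≤ |B₁| ρ³ C³` can ever be used; for larger `γ` the level-`C` statement
is literally the rung `X_C`. [folklore] -/
theorem no_witness_above_rate_ceiling {C ν T ρ γ : ℝ} (hν : 0 < ν) (hρ : 0 ≤ ρ) {u : ℝ → EuclideanSpace ℝ (Fin 3) → EuclideanSpace ℝ (Fin 3)}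
    (hrate : ∀ᶠ t in 𝓝[<] T, ∀ x, Real.sqrt (T - t) * ‖u t x‖ ≤ C * Real.sqrt ν)
    (hconc : ∃ x₀ : EuclideanSpace ℝ (Fin 3), ∀ᶠ t in 𝓝[<] T,
      γ * ν ^ 3 ≤ ∫ x in ball x₀ (ρ * Real.sqrt (ν * (T - t))), ‖u t x‖ ^ 3) :
    γ ≤ (volume (Metric.ball (0 : EuclideanSpace ℝ (Fin 3)) 1)).toReal * ρ ^ 3 * C ^ 3 := by
  obtain ⟨x₀, hx₀⟩ := hconc
  obtain ⟨t, ht1, ht2⟩ := (hx₀.and (mass_le_of_rate hν.le hrate hρ x₀)).exists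
  have h := ht1.trans ht2
  have hν3 : 0 < ν ^ 3 := by positivity
  nlinarith

/-! ## `¬ HasSmoothExtensionPast` is load-bearing (the rest state) -/

/-- **`¬ HasSmoothExtensionPast` is load-bearing.** The crux with that hypothesis dropped is FALSE:
the rest state `u ≡ 0`, `p ≡ 0` is a classical Leray–Hopf solution with Schwartz datum and the
Type-I(`C`) rate for every `C`, while its local `L³` mass is `0 < γ ν³`. [folklore] -/
theorem typeIConcentration_false_without_noExtension :
    ¬ (∀ C : ℝ, 0 < C → ∃ ρ : ℝ, 0 < ρ ∧ ∃ γ : ℝ, 0 < γ ∧ ∀ (ν T : ℝ), 0 < ν → 0 < T →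
      ∀ (u : ℝ → EuclideanSpace ℝ (Fin 3) → EuclideanSpace ℝ (Fin 3)) (p : ℝ → EuclideanSpace ℝ (Fin 3) → ℝ),
        IsClassicalNSSolutionOn (Set.Ico 0 T) ν 0 u p → IsLerayHopfOn T ν 0 (u 0) u →
        HasRapidSpatialDecay (u 0) →
        (∀ᶠ t in 𝓝[<] T, ∀ x, Real.sqrt (T - t) * ‖u t x‖ ≤ C * Real.sqrt ν) →
        ∃ x₀ : EuclideanSpace ℝ (Fin 3), ∀ᶠ t in 𝓝[<] T,
          γ * ν ^ 3 ≤ ∫ x in ball x₀ (ρ * Real.sqrt (ν * (T - t))), ‖u t x‖ ^ 3) := by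
  intro h
  obtain ⟨ρ, -, γ, hγ, h⟩ := h 1 one_pos
  have hrate : ∀ᶠ t in 𝓝[<] (1 : ℝ), ∀ x : EuclideanSpace ℝ (Fin 3),
      Real.sqrt (1 - t) * ‖(0 : ℝ → EuclideanSpace ℝ (Fin 3) → EuclideanSpace ℝ (Fin 3)) t x‖ ≤ 1 * Real.sqrt 1 :=
    Eventually.of_forall fun t x => by simp
  have hdec0 : HasRapidSpatialDecay (0 : EuclideanSpace ℝ (Fin 3) → EuclideanSpace ℝ (Fin 3)) := by
    simpa [drift_zero (gI_zero 1)] using drift_rapidDecay (g := gI 1) (gI_zero 1)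
  obtain ⟨x₀, hx₀⟩ := h 1 1 one_pos one_pos 0 0 (isClassicalNSSolutionOn_zero _ _)
    (isLerayHopfOn_zero (E := EuclideanSpace ℝ (Fin 3)) 1 1) hdec0 hrate
  obtain ⟨t, ht⟩ := hx₀.exists
  simp at ht
  exact absurd ht (not_le.2 hγ)

/-! ## `IsLerayHopfOn` (finite energy) is load-bearing: the Type-I drift nucleates from nothing -/

/-- The Type-I drift has collapse Reynolds number `≤ C` at EVERY `t ∈ [0,1)` as soon as `c ≤ C`:
`√(1−t) ‖u(t,x)‖ = c (1 − √(1−t)) ≤ c ≤ C`. [folklore] -/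
theorem driftI_rate_all {c C : ℝ} (hc : 0 ≤ c) (hcC : c ≤ C) {t : ℝ} (ht : t ∈ Ico (0 : ℝ) 1)
    (x : EuclideanSpace ℝ (Fin 3)) : Real.sqrt (1 - t) * ‖drift (gI c) t x‖ ≤ C * Real.sqrt 1 := by
  have hg : 0 ≤ gI c t := gI_nonneg c hc ht.1 ht.2
  have hs1 := sqrt_one_sub_le_one ht.1
  have hs0 : 0 ≤ Real.sqrt (1 - t) := Real.sqrt_nonneg _
  rw [norm_drift, abs_of_nonneg hg, Real.sqrt_one, sqrt_mul_gI c ht.2]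
  nlinarith

/-- Eventual form of `driftI_rate_all` (the rate hypothesis of the crux at `ν = T = 1`). [folklore] -/
theorem driftI_rate_eventually {c C : ℝ} (hc : 0 ≤ c) (hcC : c ≤ C) :
    ∀ᶠ t in 𝓝[<] (1 : ℝ), ∀ x : EuclideanSpace ℝ (Fin 3), Real.sqrt (1 - t) * ‖drift (gI c) t x‖ ≤ C * Real.sqrt 1 := by
  filter_upwards [Ioo_mem_nhdsLT (zero_lt_one' ℝ)] with t ht x
  exact driftI_rate_all hc hcC ⟨ht.1.le, ht.2⟩ x

/-- Local `L³` mass of a drift in closed form: `∫_{B(x₀,r)} ‖u(t)‖³ = r³ |B₁| |g(t)|³`. [folklore] -/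
theorem mass_drift_eq (g : ℝ → ℝ) (t : ℝ) (x₀ : EuclideanSpace ℝ (Fin 3)) {r : ℝ} (hr : 0 ≤ r) :
    ∫ x in ball x₀ r, ‖drift g t x‖ ^ 3 = r ^ 3 * (volume (Metric.ball (0 : EuclideanSpace ℝ (Fin 3)) 1)).toReal * |g t| ^ 3 := by
  simp only [norm_drift]
  rw [setIntegral_const, volume_real_ball_eq x₀ hr, smul_eq_mul]

/-- **Similarity-scale mass of the Type-I drift**: `|B₁| ρ³ c³ (1 − √(1−t))³ ≤ |B₁| ρ³ c³` around
every centre at every `t ∈ [0,1)` (`ν = T = 1`). [folklore] -/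
theorem mass_driftI_le {c ρ : ℝ} (hc : 0 ≤ c) (hρ : 0 ≤ ρ) {t : ℝ} (ht : t ∈ Ico (0 : ℝ) 1)
    (x₀ : EuclideanSpace ℝ (Fin 3)) :
    ∫ x in ball x₀ (ρ * Real.sqrt (1 * (1 - t))), ‖drift (gI c) t x‖ ^ 3 ≤ (volume (Metric.ball (0 : EuclideanSpace ℝ (Fin 3)) 1)).toReal * ρ ^ 3 * c ^ 3 := by
  have hs0 : 0 ≤ Real.sqrt (1 - t) := Real.sqrt_nonneg _
  rw [one_mul, mass_drift_eq _ _ _ (by positivity), abs_of_nonneg (gI_nonneg c hc ht.1 ht.2)]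
  have hkey : (ρ * Real.sqrt (1 - t)) ^ 3 * (volume (Metric.ball (0 : EuclideanSpace ℝ (Fin 3)) 1)).toReal * gI c t ^ 3 =
      (volume (Metric.ball (0 : EuclideanSpace ℝ (Fin 3)) 1)).toReal * ρ ^ 3 * (Real.sqrt (1 - t) * gI c t) ^ 3 := by ring
  rw [hkey, sqrt_mul_gI c ht.2]
  have hs1 : Real.sqrt (1 - t) ≤ 1 := sqrt_one_sub_le_one ht.1
  have h1 : (1 - Real.sqrt (1 - t)) ^ 3 ≤ 1 := pow_le_one₀ (by linarith) (by linarith)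
  have h2 : 0 ≤ (volume (Metric.ball (0 : EuclideanSpace ℝ (Fin 3)) 1)).toReal * ρ ^ 3 * c ^ 3 := by have := ENNReal.toReal_pos (measure_ball_pos volume (0 : EuclideanSpace ℝ (Fin 3)) one_pos).ne' (measure_ball_lt_top (x := (0 : EuclideanSpace ℝ (Fin 3))) (r := 1)).ne; positivity
  calc (volume (Metric.ball (0 : EuclideanSpace ℝ (Fin 3)) 1)).toReal * ρ ^ 3 * (c * (1 - Real.sqrt (1 - t))) ^ 3
      = (volume (Metric.ball (0 : EuclideanSpace ℝ (Fin 3)) 1)).toReal * ρ ^ 3 * c ^ 3 * (1 - Real.sqrt (1 - t)) ^ 3 := by ring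
    _ ≤ (volume (Metric.ball (0 : EuclideanSpace ℝ (Fin 3)) 1)).toReal * ρ ^ 3 * c ^ 3 * 1 := by gcongr
    _ = (volume (Metric.ball (0 : EuclideanSpace ℝ (Fin 3)) 1)).toReal * ρ ^ 3 * c ^ 3 := mul_one _

/-- `g_c(t) > 0` for `0 < t < 1`, `c > 0`. [folklore] -/
theorem gI_pos {c t : ℝ} (hc : 0 < c) (ht : t ∈ Ioo (0 : ℝ) 1) : 0 < gI c t := by
  have h1 : 0 < 1 - t := by linarith [ht.2]
  have h2 : Real.sqrt (1 - t) < 1 := by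
    rw [Real.sqrt_lt' one_pos]; linarith [ht.1]
  have h3 : 0 < Real.sqrt (1 - t) := Real.sqrt_pos.2 h1
  have h4 : 1 < (Real.sqrt (1 - t))⁻¹ := (one_lt_inv_iff₀).2 ⟨h3, h2⟩
  unfold gI
  exact mul_pos hc (by linarith)

/-- **The one clause of the crux the Type-I drift violates**: for `0 < t < 1` its velocity slice is
a non-zero constant field, hence not in `L²(ℝ³)` — `IsLerayHopfOn.memLp` (finite kinetic energy)
fails, and with it the energy inequality / weak formulation / mild representation. [folklore] -/
theorem not_memLp_driftI {c : ℝ} (hc : 0 < c) {t : ℝ} (ht : t ∈ Ioo (0 : ℝ) 1) :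
    ¬ MemLp (drift (gI c) t) 2 (volume : Measure (EuclideanSpace ℝ (Fin 3))) := by
  have hne : gI c t • driftDir ≠ 0 := smul_ne_zero (gI_pos hc ht).ne' driftDir_ne_zero
  rw [drift_apply, memLp_const_iff two_ne_zero ENNReal.ofNat_ne_top]
  rintro (h | h)
  · exact hne h
  · simp [measure_univ_of_isAddLeftInvariant] at h

/-- Consequently the Type-I drift is not Leray–Hopf on `[0, 1)`, for any viscosity. [folklore] -/
theorem not_isLerayHopfOn_driftI {c : ℝ} (hc : 0 < c) (ν : ℝ) :
    ¬ IsLerayHopfOn 1 ν 0 (drift (gI c) 0) (drift (gI c)) := fun h =>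
  not_memLp_driftI hc (t := 1 / 2) ⟨by norm_num, by norm_num⟩ (h.memLp (1 / 2) ⟨by norm_num, by norm_num⟩)

/-- **Finite energy is load-bearing, level by level.** For every `C > 0` the level-`C` instance of
the crux with the hypothesis `IsLerayHopfOn T ν 0 (u 0) u` deleted is FALSE: given `(ρ, γ)`, the
Type-I drift with `c = min(1, C, γ/(2(|B₁|ρ³ + 1)))` is classical for `ν = T = 1`, starts from
the Schwartz datum `0`, has the rate `≤ c ≤ C` on all of `[0,1)`, does not extend past `1`, and its
similarity-scale `L³` mass is `≤ |B₁| ρ³ c³ < γ` around every centre at every time. So `γ(C)`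
cannot come from the rate, the PDE identity and the datum: it is paid for by the energy structure
(ε-regularity / no-nucleation). [folklore] -/
theorem typeIConcentration_level_false_without_LerayHopf (C : ℝ) (hC : 0 < C) :
    ¬ (∃ ρ : ℝ, 0 < ρ ∧ ∃ γ : ℝ, 0 < γ ∧ ∀ (ν T : ℝ), 0 < ν → 0 < T →
      ∀ (u : ℝ → EuclideanSpace ℝ (Fin 3) → EuclideanSpace ℝ (Fin 3)) (p : ℝ → EuclideanSpace ℝ (Fin 3) → ℝ),
        IsClassicalNSSolutionOn (Set.Ico 0 T) ν 0 u p →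
        HasRapidSpatialDecay (u 0) →
        (∀ᶠ t in 𝓝[<] T, ∀ x, Real.sqrt (T - t) * ‖u t x‖ ≤ C * Real.sqrt ν) →
        ¬ HasSmoothExtensionPast ν 0 u T →
        ∃ x₀ : EuclideanSpace ℝ (Fin 3), ∀ᶠ t in 𝓝[<] T,
          γ * ν ^ 3 ≤ ∫ x in ball x₀ (ρ * Real.sqrt (ν * (T - t))), ‖u t x‖ ^ 3) := by
  rintro ⟨ρ, hρ, γ, hγ, h⟩
  set K : ℝ := (volume (Metric.ball (0 : EuclideanSpace ℝ (Fin 3)) 1)).toReal * ρ ^ 3 with hK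
  have hK0 : 0 ≤ K := by have := ENNReal.toReal_pos (measure_ball_pos volume (0 : EuclideanSpace ℝ (Fin 3)) one_pos).ne' (measure_ball_lt_top (x := (0 : EuclideanSpace ℝ (Fin 3))) (r := 1)).ne; positivity
  set c : ℝ := min 1 (min C (γ / (2 * (K + 1)))) with hc
  have hc0 : 0 < c := lt_min one_pos (lt_min hC (by positivity))
  have hc1 : c ≤ 1 := min_le_left _ _
  have hcC : c ≤ C := (min_le_right _ _).trans (min_le_left _ _)
  have hc4 : c ≤ γ / (2 * (K + 1)) := (min_le_right _ _).trans (min_le_right _ _)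
  have hcγ : K * c ^ 3 < γ := by
    have h3 : c ^ 3 ≤ c := by
      have : c ^ 3 = c * (c * c) := by ring
      rw [this]
      exact mul_le_of_le_one_right hc0.le (by nlinarith)
    have h5 : K * c ≤ K * (γ / (2 * (K + 1))) := mul_le_mul_of_nonneg_left hc4 hK0
    have h6 : K * (γ / (2 * (K + 1))) < γ := by
      rw [mul_div_assoc', div_lt_iff₀ (by positivity)]
      nlinarith
    nlinarith [mul_le_mul_of_nonneg_left h3 hK0]
  obtain ⟨x₀, hx₀⟩ := h 1 1 one_pos one_pos (drift (gI c)) (driftP (gI c))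
    (drift_isClassical (gI_contDiffOn c) 1) (drift_rapidDecay (gI_zero c))
    (driftI_rate_eventually hc0.le hcC)
    (drift_not_hasSmoothExtensionPast (tendsto_abs_gI_atTop c hc0) 1)
  obtain ⟨t, ht1, ht2⟩ := (hx₀.and (Ioo_mem_nhdsLT one_pos)).exists
  have hle := mass_driftI_le hc0.le hρ.le ⟨ht2.1.le, ht2.2⟩ x₀
  rw [one_pow, mul_one] at ht1
  have hKc : K * c ^ 3 = (volume (Metric.ball (0 : EuclideanSpace ℝ (Fin 3)) 1)).toReal * ρ ^ 3 * c ^ 3 := by rw [hK]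
  linarith

/-- **Finite energy is load-bearing, the crux verbatim.** `TypeIConcentration` with the hypothesis
`IsLerayHopfOn T ν 0 (u 0) u` deleted is FALSE (level `C = 1`). [folklore] -/
theorem typeIConcentration_false_without_LerayHopf :
    ¬ (∀ C : ℝ, 0 < C → ∃ ρ : ℝ, 0 < ρ ∧ ∃ γ : ℝ, 0 < γ ∧ ∀ (ν T : ℝ), 0 < ν → 0 < T →
      ∀ (u : ℝ → EuclideanSpace ℝ (Fin 3) → EuclideanSpace ℝ (Fin 3)) (p : ℝ → EuclideanSpace ℝ (Fin 3) → ℝ),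
        IsClassicalNSSolutionOn (Set.Ico 0 T) ν 0 u p →
        HasRapidSpatialDecay (u 0) →
        (∀ᶠ t in 𝓝[<] T, ∀ x, Real.sqrt (T - t) * ‖u t x‖ ≤ C * Real.sqrt ν) →
        ¬ HasSmoothExtensionPast ν 0 u T →
        ∃ x₀ : EuclideanSpace ℝ (Fin 3), ∀ᶠ t in 𝓝[<] T,
          γ * ν ^ 3 ≤ ∫ x in ball x₀ (ρ * Real.sqrt (ν * (T - t))), ‖u t x‖ ^ 3) := fun h =>
  typeIConcentration_level_false_without_LerayHopf 1 one_pos (h 1 one_pos)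

/-! ## The same witness against the support item `ScaledEnergyBound` (stmt-…-2884) -/

/-- Scaled local energy of a drift in closed form: `r⁻¹ ∫_{B_r(x₀)} ‖u(t)‖² = |B₁| r² g(t)²`. [folklore] -/
theorem scaledEnergy_drift_eq (g : ℝ → ℝ) (t : ℝ) (x₀ : EuclideanSpace ℝ (Fin 3)) {r : ℝ} (hr : 0 < r) :
    r⁻¹ * (∫ x in ball x₀ r, ‖drift g t x‖ ^ 2) = (volume (Metric.ball (0 : EuclideanSpace ℝ (Fin 3)) 1)).toReal * r ^ 2 * g t ^ 2 := by
  simp only [norm_drift, sq_abs]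
  rw [setIntegral_const, volume_real_ball_eq x₀ hr.le, smul_eq_mul]
  calc r⁻¹ * (r ^ 3 * (volume (Metric.ball (0 : EuclideanSpace ℝ (Fin 3)) 1)).toReal * g t ^ 2)
        = (r⁻¹ * r) * r ^ 2 * (volume (Metric.ball (0 : EuclideanSpace ℝ (Fin 3)) 1)).toReal * g t ^ 2 := by ring
    _ = (volume (Metric.ball (0 : EuclideanSpace ℝ (Fin 3)) 1)).toReal * r ^ 2 * g t ^ 2 := by rw [inv_mul_cancel₀ hr.ne']; ring

/-- **`ScaledEnergyBound` (stmt-NavierStokesRegularity-2884) is false without Leray–Hopf**: for the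
Type-I drift with `c = C = 1` (`ν = T = 1`) the scaled local energy at the fixed radius `r = r₀`
is `|B₁| r₀² g(t)² → ∞`, so no constant `A` bounds it eventually. The pointwise rate controls the
Morrey quantity only at radii `r ≲ √(ν(T−t))`; the uniform all-scales constant `A(C)` must come
from the energy structure (local energy inequality from `t′ = T − r²/ν`). [folklore] -/
theorem scaledEnergyBound_false_without_LerayHopf :
    ¬ (∀ C : ℝ, 0 < C → ∃ A : ℝ, ∀ (ν T : ℝ), 0 < ν → 0 < T →
      ∀ (u : ℝ → EuclideanSpace ℝ (Fin 3) → EuclideanSpace ℝ (Fin 3)) (p : ℝ → EuclideanSpace ℝ (Fin 3) → ℝ),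
        IsClassicalNSSolutionOn (Set.Ico 0 T) ν 0 u p → HasRapidSpatialDecay (u 0) →
        (∀ᶠ t in 𝓝[<] T, ∀ x, Real.sqrt (T - t) * ‖u t x‖ ≤ C * Real.sqrt ν) →
        ∃ r₀ : ℝ, 0 < r₀ ∧ ∀ᶠ t in 𝓝[<] T, ∀ x₀ : EuclideanSpace ℝ (Fin 3), ∀ r : ℝ, 0 < r → r ≤ r₀ →
          r⁻¹ * (∫ x in ball x₀ r, ‖u t x‖ ^ 2) ≤ A * ν ^ 2) := by
  intro h
  obtain ⟨A, h⟩ := h 1 one_pos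
  obtain ⟨r₀, hr₀, hev⟩ := h 1 1 one_pos one_pos (drift (gI 1)) (driftP (gI 1))
    (drift_isClassical (gI_contDiffOn 1) 1) (drift_rapidDecay (gI_zero 1))
    (driftI_rate_eventually zero_le_one le_rfl)
  have hsq : Tendsto (fun t => (volume (Metric.ball (0 : EuclideanSpace ℝ (Fin 3)) 1)).toReal * r₀ ^ 2 * gI 1 t ^ 2) (𝓝[<] 1) atTop := by
    have h2 : Tendsto (fun t => gI 1 t ^ 2) (𝓝[<] 1) atTop :=
      (tendsto_pow_atTop two_ne_zero).comp (tendsto_gI_atTop 1 one_pos)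
    exact h2.const_mul_atTop (by have := ENNReal.toReal_pos (measure_ball_pos volume (0 : EuclideanSpace ℝ (Fin 3)) one_pos).ne' (measure_ball_lt_top (x := (0 : EuclideanSpace ℝ (Fin 3))) (r := 1)).ne; positivity)
  obtain ⟨t, ⟨hle, hgt⟩, -⟩ :=
    ((hev.and (hsq.eventually_gt_atTop (A * 1 ^ 2))).and (Ioo_mem_nhdsLT one_pos)).exists
  have h1 := hle 0 r₀ hr₀ le_rfl
  rw [scaledEnergy_drift_eq (gI 1) t 0 hr₀] at h1
  exact absurd h1 (not_le.2 hgt)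

/-! ## PROP M (no nucleation of the line `oseen-tail-calm-core-confinement`) needs finite energy -/

/-- **No-nucleation is false without Leray–Hopf.** The core of the registered stub
`stub_calmCoresPersist` (line `oseen-tail-calm-core-confinement`; the same statement underlies
`stub_quietDecayUpgrade` of the line `quiet-point-subcritical-upgrade`) with its two analytic
hypotheses and the clause `IsLerayHopfOn T ν 0 (u 0) u` removed is FALSE: the Type-I drift with
`c_drift = C = 1` (`ν = T = 1`, `t₁ = 0`, `x₀ = 0`) is classical from the Schwartz datum `0` — so it
is `c`-QUIET at `t₁ = 0` on every ball, for every `c > 0` and every radius `ρ` — obeys the envelope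
`√(1−s)‖u(s,x)‖ = 1 − √(1−s) ≤ 1` on `[0,1) × ℝ³`, yet at `s = 15/16` it has
`√(1−s)‖u(s,0)‖ = 3/4 > 1/2 ≥ 4c` for `c = min(c₀, 1/8)`. The calm core NUCLEATES a Type-I
profile out of nothing, driven by the linear pressure; what excludes this in the line is exactly the
Oseen/mild representation (finite energy). [folklore] -/
theorem calmCoresPersist_core_false_without_LerayHopf :
    ¬ (∃ c₀ : ℝ, 0 < c₀ ∧ ∀ C : ℝ, 0 < C → ∀ c : ℝ, 0 < c → c ≤ c₀ → ∃ ρ : ℝ, 1 ≤ ρ ∧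
      ∀ (ν T t₁ : ℝ), 0 < ν → 0 < T → 0 ≤ t₁ → t₁ < T →
      ∀ (u : ℝ → EuclideanSpace ℝ (Fin 3) → EuclideanSpace ℝ (Fin 3)) (p : ℝ → EuclideanSpace ℝ (Fin 3) → ℝ),
        IsClassicalNSSolutionOn (Set.Ico 0 T) ν 0 u p →
        HasRapidSpatialDecay (u 0) →
        (∀ s ∈ Set.Ico t₁ T, ∀ x, Real.sqrt (T - s) * ‖u s x‖ ≤ C * Real.sqrt ν) →
        ∀ x₀ : EuclideanSpace ℝ (Fin 3),
          (∀ y ∈ Metric.closedBall x₀ (ρ * Real.sqrt (ν * (T - t₁))),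
              Real.sqrt (T - t₁) * ‖u t₁ y‖ ≤ c * Real.sqrt ν) →
          ∀ s ∈ Set.Ico t₁ T, ∀ y ∈ Metric.closedBall x₀ (Real.sqrt (ν * (T - t₁))),
            Real.sqrt (T - s) * ‖u s y‖ ≤ 4 * c * Real.sqrt ν) := by
  rintro ⟨c₀, hc₀, h⟩
  set c : ℝ := min c₀ (1 / 8) with hc
  have hc0 : 0 < c := lt_min hc₀ (by norm_num)
  have hcc₀ : c ≤ c₀ := min_le_left _ _
  have hc8 : c ≤ 1 / 8 := min_le_right _ _
  obtain ⟨ρ, -, h⟩ := h 1 one_pos c hc0 hcc₀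
  have henv : ∀ s ∈ Set.Ico (0 : ℝ) 1, ∀ x : EuclideanSpace ℝ (Fin 3),
      Real.sqrt (1 - s) * ‖drift (gI 1) s x‖ ≤ 1 * Real.sqrt 1 :=
    fun s hs x => driftI_rate_all zero_le_one le_rfl hs x
  have hquiet : ∀ y ∈ Metric.closedBall (0 : EuclideanSpace ℝ (Fin 3)) (ρ * Real.sqrt (1 * (1 - 0))),
      Real.sqrt (1 - 0) * ‖drift (gI 1) 0 y‖ ≤ c * Real.sqrt 1 := by
    intro y _
    rw [drift_zero (gI_zero 1)]
    simp [hc0.le]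
  have h15 : (15 / 16 : ℝ) ∈ Set.Ico (0 : ℝ) 1 := ⟨by norm_num, by norm_num⟩
  have hy : (0 : EuclideanSpace ℝ (Fin 3)) ∈ Metric.closedBall (0 : EuclideanSpace ℝ (Fin 3)) (Real.sqrt (1 * (1 - 0))) :=
    Metric.mem_closedBall_self (Real.sqrt_nonneg _)
  have hmain := h 1 1 0 one_pos one_pos le_rfl one_pos (drift (gI 1)) (driftP (gI 1))
    (drift_isClassical (gI_contDiffOn 1) 1) (drift_rapidDecay (gI_zero 1)) henv 0 hquiet
    (15 / 16) h15 0 hy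
  rw [norm_drift, abs_of_nonneg (gI_nonneg 1 zero_le_one h15.1 h15.2), sqrt_mul_gI 1 h15.2,
    Real.sqrt_one] at hmain
  have hs : Real.sqrt (1 - 15 / 16) = 1 / 4 := by
    rw [show (1 : ℝ) - 15 / 16 = (1 / 4) ^ 2 by norm_num, Real.sqrt_sq (by norm_num)]
  rw [hs] at hmain
  linarith

/-! ## Vacuity below Leray's floor -/

/-- **Below Leray's floor the hypotheses of the crux are contradictory.** With `C₀ > 0` the
constant of the proved support item `RungZero` (Leray 1934 §19 (3.9): no blow-up with collapse
Reynolds number `≤ C₀`), every level `C ≤ C₀` of the crux is VACUOUSLY true — a classical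
Leray–Hopf rapidly-decaying-datum solution with eventual rate constant `C ≤ C₀` extends past `T`.
The crux has content only for `C > C₀`; any constants `(ρ, γ)` serve below. [folklore] -/
theorem typeIConcentration_hyps_false_below_rungZero :
    ∃ C₀ : ℝ, 0 < C₀ ∧ ∀ C : ℝ, C ≤ C₀ → ∀ (ν T : ℝ), 0 < ν → 0 < T →
      ∀ (u : ℝ → EuclideanSpace ℝ (Fin 3) → EuclideanSpace ℝ (Fin 3)) (p : ℝ → EuclideanSpace ℝ (Fin 3) → ℝ),
        IsClassicalNSSolutionOn (Set.Ico 0 T) ν 0 u p → IsLerayHopfOn T ν 0 (u 0) u →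
        HasRapidSpatialDecay (u 0) →
        (∀ᶠ t in 𝓝[<] T, ∀ x, Real.sqrt (T - t) * ‖u t x‖ ≤ C * Real.sqrt ν) →
        ¬ HasSmoothExtensionPast ν 0 u T → False := by
  obtain ⟨C₀, hC₀, hX⟩ :=
    Summit.NavierStokesRegularity.NavierStokesRegularity.Theses.TypeICertificateLadder.RungZero_holds
  refine ⟨C₀, hC₀, fun C hC ν T hν hT u p hcl hLH hdec hrate hext => hext (hX ν T hν hT u p hcl hLH hdec ?_)⟩
  filter_upwards [hrate] with t ht x
  exact (ht x).trans (mul_le_mul_of_nonneg_right hC (Real.sqrt_nonneg _))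

end Summit.NavierStokesRegularity.NavierStokesRegularity.Theorems.TypeIConcentration.Negative

end
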